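import Literature.NumberTheory.LFunctions.ZetaLowHeightZeros
import HarnessLib

/-!
# Kernel-checked certificate: `ζ ≠ 0` on `(0, ½) × (0, 4]`

Trunk T-ANT (NumberTheory/LFunctions). One of the seven certificate files of the certified
low-height computation behind `Literature.NumberTheory.LFunctions.speiser_iff` (Levinson–Montgomery's Theorem 1 (1.2) needs
`ζ ≠ 0` on `(0,½) × (0, 10.5]` and `ζ' ≠ 0` on `(0,½) × (0, 10]`; classically Gram 1903 and
Spira 1965). The literal `Literature.NumberTheory.LFunctions.ZetaLowHeightZeros.ZetaNum.certZeta0to4` lists, for the four edges of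
`[0, ½] × [0, 4]`, pieces with quadrant labels (scaled integers at `2^48`); it was produced by
an external planner that mirrors the checker bit for bit, but its validity rests only on the
kernel evaluation `Literature.RH.ZetaNum.certZeta0to4_ok : certCheck 0 certZeta0to4 = true`
(`decide +kernel`, Euler–Maclaurin `N = 6` enclosures in fixed-point interval arithmetic and the
winding-number certificate theorem; see `ZetaLowHeightZeros.lean`). No axioms beyond
`propext`, `Classical.choice`, `Quot.sound`.

## Main results

* `Literature.NumberTheory.LFunctions.ZetaLowHeightZeros.ZetaNum.certZeta0to4_ok` — the kernel check.
* `Literature.NumberTheory.LFunctions.ZetaLowHeightZeros.ZetaNum.riemannZeta_ne_zero_Zeta0to4` — `ζ(s) ≠ 0` for `0 < Re s < ½`, `0 < Im s ≤ 4`.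
-/

namespace Literature.NumberTheory.LFunctions.ZetaLowHeightZeros.ZetaNum

/-- The certificate data for `ζ` on `[0, ½] × [0, 4]` (bottom, right, top, left edges).
[folklore] -/
def certZeta0to4 : ZetaNum.Cert :=
  ⟨0, 1125899906842624, 33482491297792, 2, [(69995082022912, 2), (109247861882880, 2), (140737488355328, 2)],
  40893457367040, 2, [(77545634529280, 3), (117046448750592, 3), (158076271329280, 3), (199964013625344, 3), (243844620746752, 3), (290345157918720, 3), (339652456218624, 3), (389600778387456, 3), (439970007351296, 3), (495347168182272, 0), (554559734808576, 0), (618575148613632, 0), (688561640701952, 0), (763934021779456, 0), (842042297024512, 0), (923497425534976, 0), (1009098271227904, 0), (1098326216802304, 0), (1125899906842624, 0)],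
  118366077452288, 0, [(140737488355328, 0)],
  36741297733632, 2, [(69102802567168, 2), (97808216489984, 2), (124464931012608, 3), (152106266787840, 3), (180689274142720, 3), (210194625724416, 3), (240608362889216, 3), (271912232026112, 3), (304001006436352, 3), (336091928330240, 3), (368087287201792, 3), (400053655044096, 3), (432030760304640, 3), (464028266659840, 3), (496022551789568, 3), (529846492987392, 0), (565640750432256, 0), (603592155201536, 0), (643941225463808, 0), (686980018995200, 0), (733041395761152, 0), (780448171032576, 0), (829050020954112, 0), (879042366537728, 0), (930661430984704, 0), (984177797234688, 0), (1039892112998400, 0), (1098128648306688, 0), (1125899906842624, 0)]⟩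

/-- **The kernel check of the certificate.** [folklore] -/
theorem certZeta0to4_ok : ZetaNum.certCheck 0 certZeta0to4 = true := by
  decide +kernel

/-- **`ζ(s) ≠ 0` for `0 < Re s < ½`, `0 < Im s ≤ 4`** (certified computation).
[folklore] -/
theorem riemannZeta_ne_zero_Zeta0to4 {s : ℂ} (h0 : 0 < s.re) (h1 : s.re < 1 / 2)
    (h2 : (0 : ℝ) < s.im) (h3 : s.im ≤ 4) : riemannZeta s ≠ 0 :=
  ZetaNum.riemannZeta_ne_zero_of_certCheck certZeta0to4_ok h0 h1
    (by norm_num [certZeta0to4, Literature.Analysis.ValidatedNumerics.Numerics.SC]; exact h2)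
    (by norm_num [certZeta0to4, Literature.Analysis.ValidatedNumerics.Numerics.SC]; exact h3)

end Literature.NumberTheory.LFunctions.ZetaLowHeightZeros.ZetaNum
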